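import Summits.CriticalPhenomena.PercolationContinuityZ3.Theorems.TallClusterMassBound.Negative.MassExponentFamily

/-!
# `TallClusterMassBound` (stmt-CriticalPhenomena-0912), line `replica-overlap-cs-transfer`:
# the rigorous FLOOR of the top-shell overlap — the exponent of `stub_topShellOverlap` cannot go below `-1`

Negative-side support (drefute) for the registered stub `stub_topShellOverlap`
(`Σ_{x ∈ B_n ∖ B_{n/2}} P_{p_c}(0 ↔_ℍ x, arm_ℍ(0,n))² ≤ C n^{5/2} π(n)²`), recording the rigorous window of the
exponent family `TopShellOverlapAt p s : Σ_shell P² ≤ C n^s π²`: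

* `card_conn_shell_ge` : on `arm_ℍ(0,n)` at least `n - n/2` vertices of the top shell are joined to `0` in `ℍ`
  (the witnessing open path meets every sup-norm level in `(n/2, n]`);
* `sub_half_mul_armProb_le_shellMass` : `(n - n/2) π_p(n) ≤ Σ_shell P_p(0 ↔_ℍ x, arm_n)` for every `p`;
* `armProb_sq_le_mul_shellOverlap` : Cauchy–Schwarz ⇒ `π_p(n)² ≤ 108 n · Σ_shell P_p(0 ↔_ℍ x, arm_n)²` (`n ≥ 1`);
* `not_topShellOverlapAt_of_lt_neg_one` : hence `TopShellOverlapAt p_c s` is FALSE for every `s < -1`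
  (`s = 3` is free, the stub claims `s = 5/2`; nothing rigorous is known in `(-1, 3)`).

Nothing here asserts a Theses statement.
-/

noncomputable section

open MeasureTheory Finset Filter
open Literature.Probability.Percolation Literature.Probability.LatticeModels

namespace Summit.CriticalPhenomena.PercolationContinuityZ3.Theorems.TallClusterMassBound.Negative

/-- The exponent family of the top-shell overlap stub: `Σ_{x ∈ B_n ∖ B_{n/2}} P_p(0 ↔_ℍ x, arm_n)² ≤ C n^s π_p(n)²`
for all `n ≥ 1` (`stub_topShellOverlap` is `TopShellOverlapAt p_c (5/2)`). [folklore] -/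
def TopShellOverlapAt (p : unitInterval) (s : ℝ) : Prop :=
  ∃ C : ℝ, ∀ n : ℕ, 1 ≤ n →
    ∑ x ∈ annulus 3 (n / 2) n, ((Pp p).real (conn x ∩ arm n)) ^ 2 ≤ C * (n : ℝ) ^ s * (armProb p n) ^ 2

/-- The top shell in terms of the sup-norm: `x ∈ B_n ∖ B_m ↔ m < ‖x‖∞ ≤ n`. [folklore] -/
theorem mem_annulus_iff_snorm {m n : ℕ} {z : V3} : z ∈ annulus 3 m n ↔ m < snorm z ∧ snorm z ≤ n := by
  rw [mem_annulus, mem_box_iff_snorm, mem_box_iff_snorm]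
  omega

open scoped Classical in
/-- COUNTING LEMMA (shell version of `card_conn_ge`): on `arm_ℍ(0,n)`, at least `n - n/2` vertices of the top
shell `B_n ∖ B_{n/2}` are joined to `0` in `ℍ` (configurations opening only lattice edges). [folklore] -/
theorem card_conn_shell_ge {ω : BondConfig V3} (hω : ω ⊆ (zdGraph 3).edgeSet) {n : ℕ} (hn : ω ∈ arm n) :
    n - n / 2 ≤ ((annulus 3 (n / 2) n).filter fun x => ω ∈ conn x).card := by
  classical
  obtain ⟨y, hy, ⟨w⟩⟩ := mem_arm_iff.1 hn
  have hK : ∀ u v, (openGraph ω ⊓ withinGraph ⊤ Hs).Adj u v → snorm v ≤ snorm u + 1 := by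
    intro u v h
    have h1 : (openGraph ω).Adj u v := h.1
    rw [openGraph_adj] at h1
    exact snorm_le_of_adj ((SimpleGraph.mem_edgeSet (G := zdGraph 3)).1 (hω h1.1))
  have hex : ∀ k, k ≤ n → ∃ z, z ∈ w.support ∧ snorm z = k := fun k hk =>
    exists_mem_support_eq snorm hK w (by simp) (hk.trans hy)
  choose! g hg using hex
  have hmaps : Set.MapsTo g ↑(Finset.Ioc (n / 2) n) ↑((annulus 3 (n / 2) n).filter fun x => ω ∈ conn x) := by
    intro k hk
    rw [Finset.coe_Ioc, Set.mem_Ioc] at hk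
    obtain ⟨hsupp, hnorm⟩ := hg k hk.2
    rw [Finset.mem_coe, Finset.mem_filter, mem_annulus_iff_snorm]
    refine ⟨⟨by omega, by omega⟩, ?_⟩
    rw [mem_conn_iff]
    obtain ⟨q, -, -⟩ := SimpleGraph.Walk.mem_support_iff_exists_append.1 hsupp
    exact ⟨q⟩
  have hinj : Set.InjOn g ↑(Finset.Ioc (n / 2) n) := by
    intro a ha b hb hab
    rw [Finset.coe_Ioc, Set.mem_Ioc] at ha hb
    rw [← (hg a ha.2).2, ← (hg b hb.2).2, hab]
  calc n - n / 2 = (Finset.Ioc (n / 2) n).card := (Nat.card_Ioc _ _).symm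
    _ ≤ _ := Finset.card_le_card_of_injOn g hmaps hinj

/-- LOWER BOUND on the shell mass: `(n - n/2) π_p(n) ≤ Σ_{x ∈ B_n ∖ B_{n/2}} P_p(0 ↔_ℍ x, arm_n)`. [folklore] -/
theorem sub_half_mul_armProb_le_shellMass (p : unitInterval) (n : ℕ) :
    ((n - n / 2 : ℕ) : ℝ) * armProb p n ≤ ∑ x ∈ annulus 3 (n / 2) n, (Pp p).real (conn x ∩ arm n) := by
  classical
  have hA := measurableSet_arm n
  have hC := measurableSet_conn
  have lhs : ((n - n / 2 : ℕ) : ℝ) * armProb p n =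
      ∫ ω, ((n - n / 2 : ℕ) : ℝ) * (arm n).indicator (1 : BondConfig V3 → ℝ) ω ∂Pp p := by
    rw [integral_const_mul, integral_indicator_one hA]; rfl
  have rhs : ∑ x ∈ annulus 3 (n / 2) n, (Pp p).real (conn x ∩ arm n) =
      ∫ ω, ∑ x ∈ annulus 3 (n / 2) n, (conn x ∩ arm n).indicator (1 : BondConfig V3 → ℝ) ω ∂Pp p := by
    rw [integral_finsetSum]
    · refine Finset.sum_congr rfl fun x _ => ?_
      rw [integral_indicator_one ((hC x).inter hA)]
    · intro x _
      exact (integrable_const (1 : ℝ)).indicator ((hC x).inter hA)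
  rw [lhs, rhs]
  refine integral_mono_ae ?_ ?_ ?_
  · exact ((integrable_const (1 : ℝ)).indicator hA).const_mul _
  · exact integrable_finsetSum _ fun x _ => (integrable_const (1 : ℝ)).indicator ((hC x).inter hA)
  · filter_upwards [ae_subset_edgeSet p] with ω hω
    by_cases hω' : ω ∈ arm n
    · have hsum : ∑ x ∈ annulus 3 (n / 2) n, (conn x ∩ arm n).indicator (1 : BondConfig V3 → ℝ) ω =
          (((annulus 3 (n / 2) n).filter fun x => ω ∈ conn x).card : ℝ) := by
        rw [← Finset.sum_boole]
        refine Finset.sum_congr rfl fun x _ => ?_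
        simp [Set.indicator_apply, hω']
      simp only [Set.indicator_of_mem hω', Pi.one_apply, mul_one, hsum]
      exact_mod_cast card_conn_shell_ge hω hω'
    · simp only [Set.indicator_of_notMem hω', mul_zero]
      exact Finset.sum_nonneg fun x _ => Set.indicator_nonneg (fun _ _ => zero_le_one) _

/-- The top shell has at most `27 n³` points (`n ≥ 1`). [folklore] -/
theorem card_annulus_le_cube {n : ℕ} (hn : 1 ≤ n) (m : ℕ) : (#(annulus 3 m n) : ℝ) ≤ 27 * (n : ℝ) ^ 3 := by
  have h1 : #(annulus 3 m n) ≤ #(box 3 n) := Finset.card_le_card Finset.sdiff_subset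
  have h2 : (#(annulus 3 m n) : ℝ) ≤ (#(box 3 n) : ℝ) := by exact_mod_cast h1
  refine h2.trans ?_
  rw [card_box]
  push_cast
  have h1' : (1 : ℝ) ≤ n := by exact_mod_cast hn
  nlinarith [h1', sq_nonneg ((n : ℝ) - 1), mul_pos (by linarith : (0 : ℝ) < n) (by linarith : (0 : ℝ) < n)]

/-- CAUCHY–SCHWARZ FLOOR: `π_p(n)² ≤ 108 n · Σ_{x ∈ B_n ∖ B_{n/2}} P_p(0 ↔_ℍ x, arm_n)²` for `n ≥ 1`
(`(n/2)² π² ≤ (Σ_shell P)² ≤ |shell| Σ_shell P² ≤ 27 n³ Σ_shell P²`). [folklore] -/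
theorem armProb_sq_le_mul_shellOverlap (p : unitInterval) {n : ℕ} (hn : 1 ≤ n) :
    (armProb p n) ^ 2 ≤ 108 * (n : ℝ) * ∑ x ∈ annulus 3 (n / 2) n, ((Pp p).real (conn x ∩ arm n)) ^ 2 := by
  set s := annulus 3 (n / 2) n with hs
  set A : ℝ := ∑ x ∈ s, (Pp p).real (conn x ∩ arm n) with hA
  set Q : ℝ := ∑ x ∈ s, ((Pp p).real (conn x ∩ arm n)) ^ 2 with hQ
  have hn0 : (0 : ℝ) < n := by exact_mod_cast hn
  have hπ := armProb_nonneg p n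
  have hhalf : (n : ℝ) / 2 ≤ ((n - n / 2 : ℕ) : ℝ) := by
    have h2 : n ≤ 2 * (n - n / 2) := by omega
    have h2' : (n : ℝ) ≤ 2 * ((n - n / 2 : ℕ) : ℝ) := by exact_mod_cast h2
    linarith
  have hlow : (n : ℝ) / 2 * armProb p n ≤ A := by
    calc (n : ℝ) / 2 * armProb p n ≤ ((n - n / 2 : ℕ) : ℝ) * armProb p n :=
          mul_le_mul_of_nonneg_right hhalf hπ
      _ ≤ A := sub_half_mul_armProb_le_shellMass p n
  have hlow0 : 0 ≤ (n : ℝ) / 2 * armProb p n := by positivity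
  have hCS : A ^ 2 ≤ Q * (#s : ℝ) := by
    have h := Finset.sum_mul_sq_le_sq_mul_sq s (fun x => (Pp p).real (conn x ∩ arm n)) (fun _ => (1 : ℝ))
    simpa [hA, hQ] using h
  have hQ0 : 0 ≤ Q := Finset.sum_nonneg fun x _ => sq_nonneg _
  have hcard : (#s : ℝ) ≤ 27 * (n : ℝ) ^ 3 := card_annulus_le_cube hn _
  have key : ((n : ℝ) / 2 * armProb p n) ^ 2 ≤ Q * (27 * (n : ℝ) ^ 3) :=
    calc ((n : ℝ) / 2 * armProb p n) ^ 2 ≤ A ^ 2 := pow_le_pow_left₀ hlow0 hlow 2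
      _ ≤ Q * (#s : ℝ) := hCS
      _ ≤ Q * (27 * (n : ℝ) ^ 3) := mul_le_mul_of_nonneg_left hcard hQ0
  have key' : (n : ℝ) ^ 2 * (armProb p n) ^ 2 ≤ (n : ℝ) ^ 2 * (108 * (n : ℝ) * Q) := by nlinarith [key]
  exact le_of_mul_le_mul_left key' (by positivity)

/-- NATURAL STRENGTHENING REFUTED (exponent side of stub 1): at `p_c(ℤ³)` the top-shell overlap inequality
with ANY exponent `s < -1` is false — `π(n)²/(108 n) ≤ Σ_shell P² ≤ C n^s π(n)²` and `π(n) > 0` would give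
`n^{-1}/108 ≤ C n^s` for all `n ≥ 1`. (The stub claims `s = 5/2`; `s = 3` is free.) [folklore] -/
theorem not_topShellOverlapAt_of_lt_neg_one {s : ℝ} (hs : s < -1) : ¬ TopShellOverlapAt (criticalProbI 3) s := by
  rintro ⟨C, hC⟩
  refine not_forall_rpow_le (c := 1 / 108) (C := C) (s := s) (t := -1) (by norm_num) hs fun n hn => ?_
  have hn0 : (0 : ℝ) < n := by exact_mod_cast hn
  have hπ := armProb_criticalProbI_pos n
  have h1 := armProb_sq_le_mul_shellOverlap (criticalProbI 3) hn
  have h2 := hC n hn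
  have h3 : (armProb (criticalProbI 3) n) ^ 2 ≤
      108 * (n : ℝ) * (C * (n : ℝ) ^ s * (armProb (criticalProbI 3) n) ^ 2) :=
    h1.trans (mul_le_mul_of_nonneg_left h2 (by positivity))
  have hπ2 : 0 < (armProb (criticalProbI 3) n) ^ 2 := pow_pos hπ 2
  have h4 : 1 ≤ 108 * (n : ℝ) * (C * (n : ℝ) ^ s) := by
    have : 1 * (armProb (criticalProbI 3) n) ^ 2 ≤
        (108 * (n : ℝ) * (C * (n : ℝ) ^ s)) * (armProb (criticalProbI 3) n) ^ 2 := by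
      rw [one_mul]; linarith [h3]
    exact le_of_mul_le_mul_right this hπ2
  rw [Real.rpow_neg_one]
  have h5 : 1 / 108 * (n : ℝ)⁻¹ = 1 / (108 * n) := by field_simp
  rw [h5, div_le_iff₀ (by positivity : (0 : ℝ) < 108 * n)]
  calc (1 : ℝ) ≤ 108 * (n : ℝ) * (C * (n : ℝ) ^ s) := h4
    _ = C * (n : ℝ) ^ s * (108 * n) := by ring

/-- `TopShellOverlapAt p 3` holds for every `p` (with `C = 27`): each term is `≤ π²`, the shell has `≤ 27 n³`
points — exponent `3` carries no information; the stub's content is the improvement `3 ↦ 5/2`. [folklore] -/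
theorem topShellOverlapAt_three (p : unitInterval) : TopShellOverlapAt p 3 := by
  refine ⟨27, fun n hn => ?_⟩
  have h3 : (n : ℝ) ^ (3 : ℝ) = (n : ℝ) ^ (3 : ℕ) := by exact_mod_cast Real.rpow_natCast (n : ℝ) 3
  rw [h3]
  have hπ := armProb_nonneg p n
  have hterm : ∀ x ∈ annulus 3 (n / 2) n, ((Pp p).real (conn x ∩ arm n)) ^ 2 ≤ (armProb p n) ^ 2 :=
    fun x _ => pow_le_pow_left₀ measureReal_nonneg (real_conn_inter_arm_le p x n) 2
  calc ∑ x ∈ annulus 3 (n / 2) n, ((Pp p).real (conn x ∩ arm n)) ^ 2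
      ≤ ∑ _x ∈ annulus 3 (n / 2) n, (armProb p n) ^ 2 := Finset.sum_le_sum hterm
    _ = (#(annulus 3 (n / 2) n) : ℝ) * (armProb p n) ^ 2 := by rw [Finset.sum_const, nsmul_eq_mul]
    _ ≤ 27 * (n : ℝ) ^ 3 * (armProb p n) ^ 2 :=
        mul_le_mul_of_nonneg_right (card_annulus_le_cube hn _) (sq_nonneg _)

end Summit.CriticalPhenomena.PercolationContinuityZ3.Theorems.TallClusterMassBound.Negative
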